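import Summits.Ventures.Crystal3D.Kissing125.Classification
import Summits.Ventures.Crystal3D.Bulk.RadiusTwoBarlowHolds
import HarnessLib

/-!
# W-2P Corollary, hypothesis-free: positional order at `157 · 130` (computational grade) — P5

Cell pub-crystal3d; staged by typer-bulk-2 (g13) next to `Kissing125/Classification.lean` v3 (RULING #234 (3) R1) and
filed after it (p417685) as push-button P5 of RULING #239 (4)(a). One theorem, no new mathematics:
`positionalOrder_of_bulk'` (`Bulk/RadiusTwoBarlowHolds.lean`, standard axioms, slim closure: 52 modules, 0 evaluations)
applied to the head `bulkCrystallization3D_130`. Keeps the head module's import set literal (#234 (3)) and keeps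
`Bulk/PositionalOrderRoutes130.lean` (fat imports) out of the slim referee build. Grade: that of the head (COMPUTATIONAL:
std 3 + the 323 named kernel evaluations). Nothing about GAP(1.26) or any census.
-/

namespace Summit.Ventures.Crystal3D

open Literature.Geometry.DiscreteGeometry

variable {N : ℕ}

/-- **W-2P (positional order), hypothesis-free, `157 · 130`**: in every finite sticky-sphere ground state on `N` balls
all but at most `157 · 130 · N^{2/3}` balls are centres of a Barlow (close-packed layer-stacking) patch of radius `2`
(`nonBarlowCentre`). = `positionalOrder_of_bulk' bulkCrystallization3D_130`. -/
theorem positionalOrder130 (x : Fin N → EuclideanSpace ℝ (Fin 3)) (hx : IsStickyGroundState x) :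
    ((nonBarlowCentre x).card : ℝ) ≤ 157 * 130 * (N : ℝ) ^ ((2 : ℝ) / 3) :=
  positionalOrder_of_bulk' bulkCrystallization3D_130 x hx

end Summit.Ventures.Crystal3D
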